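import Literature.LinearAlgebra.Alternating.WedgeWordsDet
import Mathlib.Data.Fin.Tuple.Sort
import HarnessLib

/-!
# Wedge monomials: sorted words suffice; multilinearity in the letters

Companion of `Literature/LinearAlgebra/Alternating/WedgeWords.lean` (spanning) and
`WedgeWordsDet.lean` (alternation in the word). Two bookkeeping tools for concrete exterior-algebra
computations (the bases `dx_{i₁} ∧ ⋯ ∧ dx_{i_k}`, `i₁ < ⋯ < i_k`, of Lange–Birkenhake (1992),
Prop. 1.1.20, and the frames `dv_I ∧ dv̄_J` of Thm. 1.1.21):

* `span_wedgeWord_image_eq_of_representatives` / `span_wedgeWord_image_eq_span_strictMono`: over a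
  permutation-invariant set of words, the span of the monomials is already spanned by a system of
  representatives of the injective words up to reordering — e.g. by the **strictly increasing**
  words for a linear order on the letters (`Tuple.sort`; a reordered monomial is `±` the original,
  `wedgeWord_comp_perm`, and non-injective words give `0`);
* `wedgeSeq c k θs = θs 0 ∧ ⋯ ∧ θs (k-1) ∧ c` for a SEQUENCE of `1`-forms and its packaging
  `wedgeSeqMultilinear` as a `𝕜'`-multilinear map in the letters (so that products of sums of
  `1`-forms expand by `MultilinearMap.map_sum`, `map_smul_univ`), with
  `wedgeWord θ c k w = wedgeSeq c k (θ ∘ w)`.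

## References

* F. W. Warner, *Foundations of Differentiable Manifolds and Lie Groups* (1983), 2.6. [Warner1983]
* H. Lange, Ch. Birkenhake, *Complex Abelian Varieties* (1992), §1.1.4 Prop. 1.1.20.
  [LangeBirkenhake1992]
-/

noncomputable section

open ContinuousAlternatingMap Function

namespace Literature.LinearAlgebra.Alternating

variable {𝕜 : Type*} [NontriviallyNormedField 𝕜] {𝕜' : Type*} [NormedField 𝕜']
  [NormedAlgebra 𝕜 𝕜'] {E : Type*} [NormedAddCommGroup E] [NormedSpace 𝕜 E]
  {F : Type*} [NormedAddCommGroup F] [NormedSpace 𝕜 F] [NormedSpace 𝕜' F]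
  [IsScalarTower 𝕜 𝕜' F]

/-! ### Representatives up to reordering -/

section Representatives

variable {σ : Type*} (θ : σ → (E →L[𝕜] 𝕜')) (c : E [⋀^Fin 0]→L[𝕜] F)

/-- A reordered monomial lies in the span of the original: `θ_{w ∘ π} ∧ c = ±(θ_w ∧ c)`.
[cite: Warner1983, 2.6] -/
theorem wedgeWord_mem_span_of_perm {k : ℕ} (w : Fin k → σ) (π : Equiv.Perm (Fin k))
    {S : Set (E [⋀^Fin k]→L[𝕜] F)} (h : wedgeWord θ c k (w ∘ π) ∈ S) :
    wedgeWord θ c k w ∈ Submodule.span 𝕜' S := by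
  have hsq : ((Equiv.Perm.sign π : ℤ) : 𝕜') * ((Equiv.Perm.sign π : ℤ) : 𝕜') = 1 := by
    rw [← Int.cast_mul, ← Units.val_mul, Int.units_mul_self, Units.val_one, Int.cast_one]
  have hw : wedgeWord θ c k w = ((Equiv.Perm.sign π : ℤ) : 𝕜') • wedgeWord θ c k (w ∘ π) := by
    rw [wedgeWord_comp_perm, smul_smul, hsq, one_smul]
  rw [hw]
  exact Submodule.smul_mem _ _ (Submodule.subset_span h)

/-- **Representatives suffice.** Let `S` be a set of words and `R ⊆ S` such that every injective
word of `S` is a reordering of a word of `R`. Then the monomials of `R` span the same subspace as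
those of `S` (non-injective words contribute `0`). [cite: Warner1983, 2.6] -/
theorem span_wedgeWord_image_eq_of_representatives {k : ℕ} {S R : Set (Fin k → σ)} (hRS : R ⊆ S)
    (hR : ∀ w ∈ S, Injective w → ∃ r ∈ R, ∃ π : Equiv.Perm (Fin k), r = w ∘ π) :
    Submodule.span 𝕜' (wedgeWord θ c k '' S) = Submodule.span 𝕜' (wedgeWord θ c k '' R) := by
  refine le_antisymm (Submodule.span_le.2 ?_) (Submodule.span_mono (Set.image_mono hRS))
  rintro _ ⟨w, hw, rfl⟩
  by_cases hinj : Injective w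
  · obtain ⟨r, hr, π, hrw⟩ := hR w hw hinj
    exact wedgeWord_mem_span_of_perm θ c w π ⟨r, hr, hrw.symm ▸ rfl⟩
  · rw [wedgeWord_eq_zero_of_not_injective θ c w hinj]
    exact Submodule.zero_mem _

/-- **Strictly increasing words suffice** (for a linear order on the letters): over a
permutation-invariant set of words, the monomials of the strictly increasing words span the same
subspace (sort an injective word with `Tuple.sort`). These are the `dx_{i₁} ∧ ⋯ ∧ dx_{i_k}`,
`i₁ < ⋯ < i_k`. [cite: LangeBirkenhake1992, §1.1.4 Prop. 1.1.20] -/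
theorem span_wedgeWord_image_eq_span_strictMono [LinearOrder σ] {k : ℕ} {S : Set (Fin k → σ)}
    (hS : ∀ w ∈ S, ∀ π : Equiv.Perm (Fin k), w ∘ π ∈ S) :
    Submodule.span 𝕜' (wedgeWord θ c k '' S) =
      Submodule.span 𝕜' (wedgeWord θ c k '' {w ∈ S | StrictMono w}) := by
  refine span_wedgeWord_image_eq_of_representatives θ c (fun w hw ↦ hw.1) fun w hw hinj ↦ ?_
  refine ⟨w ∘ Tuple.sort w, ⟨hS w hw _, ?_⟩, Tuple.sort w, rfl⟩
  exact (Tuple.monotone_sort w).strictMono_of_injective (hinj.comp (Tuple.sort w).injective)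

end Representatives

/-! ### Monomials of a sequence of `1`-forms; multilinearity in the letters -/

section Seq

variable (c : E [⋀^Fin 0]→L[𝕜] F)

/-- `wedgeSeq c k θs = θs 0 ∧ θs 1 ∧ ⋯ ∧ θs (k-1) ∧ c` for a sequence of `1`-forms.
[cite: Warner1983, 2.6] -/
def wedgeSeq : (k : ℕ) → (Fin k → (E →L[𝕜] 𝕜')) → E [⋀^Fin k]→L[𝕜] F
  | 0, _ => c
  | k + 1, θs => wedgeOne (θs 0) (wedgeSeq k (Fin.tail θs))

/-- The empty product is `c`. [folklore] -/
@[simp] theorem wedgeSeq_zero (θs : Fin 0 → (E →L[𝕜] 𝕜')) : wedgeSeq c 0 θs = c := rfl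

/-- `wedgeSeq c (k+1) θs = θs 0 ∧ wedgeSeq c k (tail θs)`. [folklore] -/
theorem wedgeSeq_succ {k : ℕ} (θs : Fin (k + 1) → (E →L[𝕜] 𝕜')) :
    wedgeSeq c (k + 1) θs = wedgeOne (θs 0) (wedgeSeq c k (Fin.tail θs)) := rfl

/-- Monomials of words are monomials of the sequence of their letters:
`wedgeWord θ c k w = wedgeSeq c k (θ ∘ w)`. [folklore] -/
theorem wedgeWord_eq_wedgeSeq {σ : Type*} (θ : σ → (E →L[𝕜] 𝕜')) :
    ∀ (k : ℕ) (w : Fin k → σ), wedgeWord θ c k w = wedgeSeq c k (θ ∘ w)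
  | 0, _ => rfl
  | k + 1, w => by
    rw [wedgeWord_succ, wedgeSeq_succ, wedgeWord_eq_wedgeSeq θ k (Fin.tail w)]
    rfl

/-- `wedgeSeq` is additive in each letter. [folklore] -/
theorem wedgeSeq_update_add : ∀ (k : ℕ) (θs : Fin k → (E →L[𝕜] 𝕜')) (i : Fin k)
    (x y : E →L[𝕜] 𝕜'),
    wedgeSeq c k (update θs i (x + y)) = wedgeSeq c k (update θs i x) + wedgeSeq c k (update θs i y)
  | 0, _, i, _, _ => i.elim0
  | k + 1, θs, i, x, y => by
    refine Fin.cases ?_ (fun i' ↦ ?_) i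
    · simp only [wedgeSeq_succ, update_self, Fin.tail_update_zero, wedgeOne_add_left]
    · simp only [wedgeSeq_succ, update_of_ne (Fin.succ_ne_zero i').symm, Fin.tail_update_succ,
        wedgeSeq_update_add k (Fin.tail θs) i' x y, wedgeOne_add]

/-- `wedgeSeq` commutes with the scalars of `𝕜'` in each letter. [folklore] -/
theorem wedgeSeq_update_smul : ∀ (k : ℕ) (θs : Fin k → (E →L[𝕜] 𝕜')) (i : Fin k) (a : 𝕜')
    (x : E →L[𝕜] 𝕜'),
    wedgeSeq c k (update θs i (a • x)) = a • wedgeSeq c k (update θs i x)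
  | 0, _, i, _, _ => i.elim0
  | k + 1, θs, i, a, x => by
    refine Fin.cases ?_ (fun i' ↦ ?_) i
    · simp only [wedgeSeq_succ, update_self, Fin.tail_update_zero, wedgeOne_smul_left]
    · simp only [wedgeSeq_succ, update_of_ne (Fin.succ_ne_zero i').symm, Fin.tail_update_succ,
        wedgeSeq_update_smul k (Fin.tail θs) i' a x, wedgeOne_smul]

/-- **`(θ₀, …, θ_{k-1}) ↦ θ₀ ∧ ⋯ ∧ θ_{k-1} ∧ c` is `𝕜'`-multilinear** (Mathlib `MultilinearMap`, so
that products of sums expand by `MultilinearMap.map_sum` / `map_smul_univ`). [cite: Warner1983, 2.6] -/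
def wedgeSeqMultilinear (k : ℕ) :
    MultilinearMap 𝕜' (fun _ : Fin k ↦ (E →L[𝕜] 𝕜')) (E [⋀^Fin k]→L[𝕜] F) :=
  MultilinearMap.mk' (wedgeSeq c k) (fun θs i x y ↦ wedgeSeq_update_add c k θs i x y)
    (fun θs i a x ↦ wedgeSeq_update_smul c k θs i a x)

/-- Unfolding of `wedgeSeqMultilinear`. [folklore] -/
@[simp] theorem wedgeSeqMultilinear_apply (k : ℕ) (θs : Fin k → (E →L[𝕜] 𝕜')) :
    wedgeSeqMultilinear c k θs = wedgeSeq c k θs := rfl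

/-- **Expansion of a product of combinations**: `⋀ᵢ (Σ_s a i s • θ_{i,s}) ∧ c =
Σ_S (∏ᵢ a i (S i)) • (⋀ᵢ θ_{i, S i}) ∧ c`, the sum over all choice functions `S`.
[cite: Warner1983, 2.6] -/
theorem wedgeSeq_sum_smul {k : ℕ} {τ : Type*} [Fintype τ] (a : Fin k → τ → 𝕜')
    (θ : Fin k → τ → (E →L[𝕜] 𝕜')) :
    wedgeSeq c k (fun i ↦ ∑ s, a i s • θ i s) =
      ∑ S : Fin k → τ, (∏ i, a i (S i)) • wedgeSeq c k (fun i ↦ θ i (S i)) := by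
  classical
  have h := (wedgeSeqMultilinear (𝕜 := 𝕜) (E := E) c k).map_sum (fun i s ↦ a i s • θ i s)
  simp only [wedgeSeqMultilinear_apply] at h
  rw [h]
  refine Finset.sum_congr rfl fun S _ ↦ ?_
  have h2 := (wedgeSeqMultilinear (𝕜 := 𝕜) (E := E) c k).map_smul_univ (fun i ↦ a i (S i))
    (fun i ↦ θ i (S i))
  simpa only [wedgeSeqMultilinear_apply] using h2

/-- `wedgeSeq` is `wedgeWord` for the tautological letter family. [folklore] -/
theorem wedgeSeq_eq_wedgeWord_id {k : ℕ} (θs : Fin k → (E →L[𝕜] 𝕜')) :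
    wedgeSeq c k θs = wedgeWord id c k θs :=
  (wedgeWord_eq_wedgeSeq c id k θs).symm

/-- Alternation of `wedgeSeq` in the letters: permuting the sequence multiplies by the sign
(`wedgeWord_comp_perm` with the tautological letter family). [cite: Warner1983, 2.6] -/
theorem wedgeSeq_comp_perm {k : ℕ} (θs : Fin k → (E →L[𝕜] 𝕜')) (π : Equiv.Perm (Fin k)) :
    wedgeSeq c k (θs ∘ π) = ((Equiv.Perm.sign π : ℤ) : 𝕜') • wedgeSeq c k θs := by
  rw [wedgeSeq_eq_wedgeWord_id, wedgeSeq_eq_wedgeWord_id]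
  exact wedgeWord_comp_perm id c θs π

/-- Swapping two letters of the sequence negates the product. [cite: Warner1983, 2.6] -/
theorem wedgeSeq_comp_swap {k : ℕ} (θs : Fin k → (E →L[𝕜] 𝕜')) {i j : Fin k} (hij : i ≠ j) :
    wedgeSeq c k (θs ∘ Equiv.swap i j) = -wedgeSeq c k θs := by
  rw [wedgeSeq_eq_wedgeWord_id, wedgeSeq_eq_wedgeWord_id]
  exact wedgeWord_comp_swap id c θs hij

/-- A repeated letter kills the product: `… ∧ θ ∧ … ∧ θ ∧ … = 0`. [cite: Warner1983, 2.6] -/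
theorem wedgeSeq_eq_zero_of_eq {k : ℕ} (θs : Fin k → (E →L[𝕜] 𝕜')) {i j : Fin k} (hij : i ≠ j)
    (h : θs i = θs j) : wedgeSeq c k θs = 0 := by
  rw [wedgeSeq_eq_wedgeWord_id]
  exact wedgeWord_eq_zero_of_eq id c θs hij h

end Seq

end Literature.LinearAlgebra.Alternating

end
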